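import Literature.AnabelianGeometry.AbsoluteAnabelian.MonoidKummerMapsIdRigidTFProofs
import Literature.AnabelianGeometry.AbsoluteAnabelian.MLFGaloisPairsWitness

/-!
# [AbsTopIII] Prop 3.2 (iv): the `TF` slot of the MONOID-pair schema is empty; the FIELD-pair schemas are not
# (proof-only kernel witnesses; abc-iut cell, RQ7 second pass of p415623/p415999 + p415973/p416253)

S. Mochizuki, *Topics in absolute anabelian geometry III*, §3, Def. 3.1 (ii) p. 67 and Prop. 3.2 (iv) p. 72
(bib key `MochizukiAbsTopIII2015`, lit key `paper:url-5493eb38cbb7`).  abc-iut-w4-d045's v2 section of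
`MonoidKummerMapsSub.lean` records in prose that `ModelMLFGaloisData.monoidPair .TF = none`, so that the
MONOID-pair category `MLFGaloisMonoidPairCat .TF` has no objects and the schema `Prop32iv_idRigid .TF H` holds
vacuously (the printed `TF` clause lives on abc-iut-L4-t2's FIELD pairs `GaloisFieldPair`, typed there as
`Prop32iv_idRigidTF` / `FieldPairIsoDeterminedByGalois` / `AutFieldPairCenterFree`).  This file puts that
bookkeeping into the kernel so that no consumer can cite the monoid `TF` slot as content, and records the
complementary NON-vacuity of the field-pair schemas:

* `ModelMLFGaloisData.monoidPair_TF` — the `TF` slot of the model monoid pair is `none` (`rfl`);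
* `not_isMLFGaloisMonoidPair_TF` — no `GaloisMonoidPair` is an MLF-Galois `TF`-pair;
* `prop32iv_idRigid_TF_of_isEmpty` — `Prop32iv_idRigid .TF H` for EVERY hypothesis predicate `H` (empty category);
* `ModelMLFGaloisData.isMLFGaloisFieldPair_fieldPair` — every model field pair `(Π_k ↷ k̄)` IS an MLF-Galois
  `TF`-pair (Def. 3.1 (ii), reflexive instance), concretely `exists_isMLFGaloisFieldPair` over `ℚ_2` with
  `Π_k = G_k × ℤ` (abc-iut-L4-t2's `MLFClosure.ofPadic` / `ModelMLFGaloisData.galProd`), whence the full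
  subcategory `𝒞^{MLF-⊤}_TF` is non-empty (`nonempty_mlfGaloisFieldPairSubcat_top`) and the binders of
  `FieldPairIsoDeterminedByGalois` are jointly satisfiable (`fieldPairIsoDeterminedByGalois_binders_inhabited`).

HONEST FRAMING: bookkeeping witnesses about OUR typing of Def. 3.1/Prop. 3.2; nothing here bears on
[IUTchIII] Cor. 3.12 and nothing asserts that abc is proved or refuted.  typed ≠ proved.
-/

namespace Literature.AnabelianGeometry.AbsoluteAnabelian

open _root_.CategoryTheory

noncomputable section

/-- The `TF` slot of the model MONOID pair is empty: `ModelMLFGaloisData.monoidPair .TF = none` (Def. 3.1 (i):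
for `T = TF` the model object is the FIELD `k̄`, carried by `ModelMLFGaloisData.fieldPair`).
[cite: MochizukiAbsTopIII2015, Definition 3.1 (i) p.67] -/
theorem ModelMLFGaloisData.monoidPair_TF (C : MLFClosure.{0}) (D : ModelMLFGaloisData C.k C.K) :
    D.monoidPair .TF = none := rfl

/-- Hence no `GaloisMonoidPair` is an MLF-Galois `TF`-pair in the sense of `IsMLFGaloisMonoidPair .TF`
(the `TF`-pairs of Def. 3.1 (ii) are the `GaloisFieldPair`s satisfying `IsMLFGaloisFieldPair`).
[cite: MochizukiAbsTopIII2015, Definition 3.1 (ii) p.67] -/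
theorem not_isMLFGaloisMonoidPair_TF (P : GaloisMonoidPair.{0}) : ¬ IsMLFGaloisMonoidPair .TF P := by
  rintro ⟨C, D, Q, hQ, -⟩
  rw [ModelMLFGaloisData.monoidPair_TF] at hQ
  exact absurd hQ (by simp)

/-- VACUITY WITNESS: the monoid-pair schema `Prop32iv_idRigid .TF H` («the categories … `𝒞^{MLF-hyp}_T`, … are
id-rigid» read in the MONOID slot at `T = TF`) holds for EVERY hypothesis predicate `H`, because the category
`MLFGaloisMonoidPairSubcat .TF H` has no objects — it is NOT the printed `TF` clause (that is
`Prop32iv_idRigidTF`, proved modulo slimness by abc-iut-w4-d045's `prop32iv_idRigidTF_of_isSlimGroup'`).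
[cite: MochizukiAbsTopIII2015, Proposition 3.2 (iv) p.72] -/
theorem prop32iv_idRigid_TF_of_isEmpty (H : GaloisMonoidPair.{0} → Prop) : Prop32iv_idRigid.{0} .TF H := by
  have hE : IsEmpty (MLFGaloisMonoidPairSubcat.{0} .TF H) :=
    ⟨fun X => not_isMLFGaloisMonoidPair_TF X.obj.obj X.obj.property⟩
  intro α
  ext X
  exact hE.elim X

/-- NON-VACUITY of the `TF` field-pair notion: every model field pair `(Π_k ↷ k̄)` of a model MLF-Galois datum
is an MLF-Galois `TF`-pair (Def. 3.1 (ii): «for some model MLF-Galois `T`-pair … there exist an isomorphism of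
topological groups `Π_k ⥲ Π` and an isomorphism of objects `M_k̄ ⥲ M` … compatible with the respective
actions» — the identity isomorphisms). [cite: MochizukiAbsTopIII2015, Definition 3.1 (ii) p.67] -/
theorem ModelMLFGaloisData.isMLFGaloisFieldPair_fieldPair (C : MLFClosure.{0})
    (D : ModelMLFGaloisData C.k C.K) : IsMLFGaloisFieldPair D.fieldPair :=
  ⟨⟨C, D, ⟨GaloisFieldPair.Iso.refl' D.fieldPair⟩⟩⟩

/-- CONCRETELY: MLF-Galois `TF`-pairs exist — the model field pair over `k = ℚ_2`, `k̄ = AlgebraicClosure ℚ_2`,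
`Π_k = G_k × ℤ ↠ G_k` (abc-iut-L4-t2's `MLFClosure.ofPadic 2`, `ModelMLFGaloisData.galProd`).
[cite: MochizukiAbsTopIII2015, Definition 3.1 (ii) p.67] -/
theorem exists_isMLFGaloisFieldPair : ∃ P : GaloisFieldPair.{0}, IsMLFGaloisFieldPair P := by
  haveI : Fact (Nat.Prime 2) := ⟨Nat.prime_two⟩
  exact ⟨_, ModelMLFGaloisData.isMLFGaloisFieldPair_fieldPair (MLFClosure.ofPadic 2)
    (ModelMLFGaloisData.galProd (MLFClosure.ofPadic 2) (Multiplicative ℤ))⟩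

/-- The full subcategory `𝒞^{MLF-H}_TF` (`MLFGaloisFieldPairSubcat H`) is non-empty at `H = ⊤`; so, unlike the
monoid `TF` slot, `Prop32iv_idRigidTF H` is a statement about a category with objects.
[cite: MochizukiAbsTopIII2015, Proposition 3.2 (iv) p.72] -/
theorem nonempty_mlfGaloisFieldPairSubcat_top : Nonempty (MLFGaloisFieldPairSubcat.{0} (fun _ => True)) := by
  obtain ⟨P, hP⟩ := exists_isMLFGaloisFieldPair
  exact ⟨⟨⟨P, hP⟩, trivial⟩⟩

/-- The binders of `FieldPairIsoDeterminedByGalois` (Prop. 3.2 (iv) injectivity at `T = TF`, PROVED by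
abc-iut-w4-d045 as `fieldPairIsoDeterminedByGalois_holds`) are jointly satisfiable: there are MLF-Galois
`TF`-pairs `P`, `Q` and isomorphisms of pairs `e₁ e₂ : P ⥲ Q` with equal Galois components — the theorem is
not vacuous. [cite: MochizukiAbsTopIII2015, Proposition 3.2 (iv) p.72] -/
theorem fieldPairIsoDeterminedByGalois_binders_inhabited :
    ∃ (P Q : GaloisFieldPair.{0}) (_ : IsMLFGaloisFieldPair P) (_ : IsMLFGaloisFieldPair Q)
      (e₁ e₂ : GaloisFieldPair.Iso P Q), e₁.isoPi = e₂.isoPi := by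
  obtain ⟨P, hP⟩ := exists_isMLFGaloisFieldPair
  exact ⟨P, P, hP, hP, GaloisFieldPair.Iso.refl' P, GaloisFieldPair.Iso.refl' P, rfl⟩

/-- Likewise the `TM` sub-subcategory `𝒞^{MLF-H}_TM` of p414730's `prop32iv_idRigid_TM_of_autPairCenterFree` is
non-empty at `H = ⊤` (the concrete witness pair `(G_{ℚ_2} × ℤ ↷ 𝒪^⊳)` of `MLFGaloisPairsWitness`), while
`AutPairCenterFree ⊤` FAILS there (`not_autPairCenterFree_top`): the hypothesis predicate of the id-rigidity
schema is load-bearing, exactly as in print («if `(Π ↷ M_T)` is of hyperbolic orbicurve type, then …»).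
[cite: MochizukiAbsTopIII2015, Proposition 3.2 (iv) p.72] -/
theorem nonempty_mlfGaloisMonoidPairSubcat_TM_top_and_not_autPairCenterFree_top :
    Nonempty (MLFGaloisMonoidPairSubcat.{0} .TM (fun _ => True)) ∧ ¬ AutPairCenterFree (fun _ => True) :=
  ⟨⟨⟨⟨AutPairCenterFreeWitness.P, AutPairCenterFreeWitness.isMLFGaloisMonoidPair_P⟩, trivial⟩⟩,
    not_autPairCenterFree_top⟩

end

end Literature.AnabelianGeometry.AbsoluteAnabelian
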